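import Summits.BirchSwinnertonDyer.BirchSwinnertonDyer.Theorems.KimAtThreeDeepLowerExpStarOmegaRes
import HarnessLib

/-!
# Galois semilinearity of the DEFINED dual exponential `exp*_ω` over a `p`-adic extension `L ⊇ K`:
# the `exp*`-half (GAL_loc) of the decomposition-group equivariance (GAL_D)/(GAL₀) behind `ZetaBody` (C3a)
# for a value datum defined at ONE completion (crux `KatoKuriharaPortThreeShared`, stmt-BirchSwinnertonDyer-19560;
# cell `bsd-addord`, seat kim3 gen 15 = the crux's LEAD; route W2 `KimAtThreeKolyvagin`; `--supports 19560`, helper)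

HONEST FRAMING.  TOOL theorems only (no definition, no named fact, no instance, no `sorry`); general prime `p`,
general `p`-adic fields `K ⊆ L`; closes nothing; nothing is booked; BSD is not proved by any of this.

## What, and why
For the single-completion value datum of w2-acc5 (`KimAtThreeFineKatoPerFactorSingle`, (DEF₀)), `ZetaBody` (C3a)
is a kernel theorem modulo (GAL₀) (`KimAtThreeFineKatoValueEquivariance` §1), and (GAL₀) reduces at the tame levels to
the genuinely LOCAL statement (GAL_D) (`KimAtThreeFineKatoValueEquivarianceStab`): Galois semilinearity of
`F = exp*_{w₀} ∘ loc^{tower}_{w₀} ∘ H1toInt` under the decomposition group.  Its `exp*`-half is THIS FILE: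

* `expStarOmega_galois` — **(GAL_loc)**.  Let `K ⊆ L` be `p`-adic fields (continuous inclusion), `r : Γ_K → Γ_ℚ`,
  `t = r ∘ res_{L/K}`, `δ' ∈ Γ_K`, `s : Γ_L → Γ_L` a continuous homomorphism with `res (s τ) = δ'⁻¹ · res τ · δ'`
  (conjugation by `δ'` transported to `Γ_L` — for `L/K` Galois the image of `res` is normal), and `g : L →+* L` the
  automorphism induced by `δ'` (`ι₀ (δ' • y) = g x` whenever `ι₀ y = x ∈ L`, `ι₀ = absClosureEmbedding K L`).  Let
  `d_K`, `d_L` be Néron lines over `K`, `L` with **(RES)** `exp*_{d_L} ∘ res = (K → L) ∘ exp*_{d_K}` and ONE class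
  `h₀ ∈ H¹(Γ_K, T_pW|_r)` with `exp*_{d_K} h₀ ≠ 0`.  Then, under the Prop-1.2.3 binders over `K` and `L`, for
  continuous crossed homomorphisms `c, c' : Γ_L → T_pW|_t` with `c'(τ) = r(δ') · c(s τ)`:
  **`exp*_{d_L}[c'] = g (exp*_{d_L}[c])`**.

PROOF ROAD.  `Θ := Φ ∘ (δ' •) ∘ Φ⁻¹` on `B_dR(L)`, where `Φ : B_dR(K) ≃ B_dR(L)` is the filtered `res`-equivariant
base-change isomorphism of `BdRBaseChangeFiltered.exists_fracBdR_ringEquiv_filtered` (the one behind w2-c2's (RES),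
p504608) and `δ' •` is the `Γ_K`-action on `B_dR(K)`: `Θ` is a filtered ring automorphism of `B_dR(L)`, equivariant over
`s` and `g`-SEMILINEAR on `L ⊆ B_dR(L)` (property (3) of `Φ`: `Φ ∘ ι_K = ι_L ∘ ι₀` for Fontaine's sections
`ι_F : F̄ → B_dR⁺(F)`, which are `Γ_F`-equivariant — `galBdRPlus_algClosureToBdR`).  w2-c2's ABSTRACT transport
(`KimAtThreeDeepLowerExpStarOmegaTransport`, used with the twisted `Algebra L L := g.toAlgebra`) gives
`exp*_{(t∘s,(Θ⊗1)ω_L)}(z ∘ s) = g (exp*_{(t,ω_L)} z)`; `FilZeroLine.map` / `dualExpCoord_map` along the intertwiner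
`φ = ρ(r δ') : V_pW|_{t∘s} ≅ V_pW|_t` moves the left side back to the representation `V_pW|_t` with SOME generator, so
`exp*_{d_L}[c'] = e · g (exp*_{d_L}[c])` for one `e ∈ Lˣ` independent of `c`; finally `e = 1` by evaluating at the
restriction `c₀ = res η₀` of a representative of `h₀`: `[τ ↦ r δ' · η₀(δ'⁻¹ res τ δ')] = [res η₀]` (they differ by
the coboundary of `η₀(δ')`), (RES) and `g|_K = id`.  No `Γ_K`-invariance of `d_L` is assumed — it is what (RES)
encodes.  NOT here: the Galois half of (GAL_D) (a representative `τ ↦ res_ℚ δ' · c(s τ)` of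
`loc^t(H1toInt(conjMap (res_ℚ δ') Y))`, the identification `g = galAdicCompletionMap σ̃(res_ℚ δ')`, the homomorphism
`s` — w2-acc5), and the Prop-1.2.3 binders / (RES) / `h₀` (cite facts (P123)/(S5b) via w2-c3 g8, w2-c2's (RES), kim3
g13 `lemmaL_range_three` on the Kato stratum).

References: K. Kato, LNM 1553 (1993) Ch. II §1.2.2–1.2.4, Prop. 1.2.3 [Kato1993LNM1553]; K. Kato, Astérisque 295
(2004) §9.4 ("`exp*` is a homomorphism of `ℚ_p[Gal(ℚ(ζ_m)/ℚ)]`-modules") [Kato2004Asterisque]; O. Brinon, B. Conrad,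
*CMI notes* (2009) p. 80 and Prop. 6.3.8 [BrinonConrad2009]; J.-M. Fontaine, Astérisque 223 (1994) Exp. II §1.5
[FontaineAsterisque223III]; J.-P. Serre, *Local Fields* (1979) VII §5 Prop. 3 (inner automorphisms act trivially on `H¹`)
[SerreLocalFields1979]; HOME STATUS 2026-08-27 w2-acc5 g5 ≈07:29Z ((GAL_D) and its currency question), kim3 g15
≈07:45Z (TAKING (GAL_loc)).
-/

set_option autoImplicit false
-- the Theorems namespace of a single-conjunct summit repeats the summit name by design (D-0017)
set_option linter.dupNamespace false

noncomputable section

open scoped TensorProduct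
open Field ValuativeRel Function WittVector
open Literature.NumberTheory.GaloisRepresentations
open Literature.NumberTheory.GaloisRepresentations.PeriodRingData
open Literature.NumberTheory.PAdicHodge
open Literature.NumberTheory.EllipticCurves
open Summit.BirchSwinnertonDyer.BirchSwinnertonDyer.Theorems.KimAtThreeDeepLowerExpStarOmega
open Summit.BirchSwinnertonDyer.BirchSwinnertonDyer.Theorems.KimAtThreeDeepLowerExpStarOmegaTransport
open Summit.BirchSwinnertonDyer.BirchSwinnertonDyer.Theorems.KimAtThreeDeepLowerExpStarOmegaRes

namespace Summit.BirchSwinnertonDyer.BirchSwinnertonDyer.Theorems.KimAtThreeFineKatoExpStarGalois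

/-! ### §1 Small inputs -/

section Inputs

variable {K L : Type} [Field K] [Field L] [Algebra K L] (p : ℕ) [Fact p.Prime] [CharZero K]

/-- **`log χ_cyclo` is invariant under the transported conjugation**: if `res (s τ) = δ'⁻¹ · res τ · δ'` then
`log χ(s τ) = log χ(τ)` (`log χ` restricts along `res` and is a homomorphism to the abelian group `ℚ_p`).
[cite: Kato1993LNM1553, Ch. II §1.2.2] -/
theorem logCyclotomic_conj (δ' : absoluteGaloisGroup K) (s : absoluteGaloisGroup L →ₜ* absoluteGaloisGroup L)
    (hs : ∀ τ, absGaloisRestrict K L (s τ) = δ'⁻¹ * absGaloisRestrict K L τ * δ') (τ : absoluteGaloisGroup L) :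
    logCyclotomic p τ = logCyclotomic p (s τ) := by
  rw [logCyclotomic_absGaloisRestrict (K := K) p τ, logCyclotomic_absGaloisRestrict (K := K) p (s τ), hs,
    logCyclotomic_mul, logCyclotomic_mul]
  have h1 : logCyclotomic p δ'⁻¹ + logCyclotomic p δ' = 0 := by
    rw [← logCyclotomic_mul, inv_mul_cancel, logCyclotomic_one]
  linear_combination -h1

end Inputs

section Equiv

universe u v v' w w'

variable {Γ : Type u} [Group Γ] [TopologicalSpace Γ] {P : Type v} [Field P] [TopologicalSpace P]
  {E : Type v'} [Field E] [Algebra P E]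
  {M : Type w'} [AddCommGroup M] [Module P M] [TopologicalSpace M]
  {𝔅 : PeriodRingData.{u, v, v', w} Γ P E} {ψ : Γ → P} {ρ ρ' : ContinuousRep Γ P M}

/-- **Injectivity of `∪ log χ` on `Fil⁰ D` is transported along an isomorphism of representations**
`φ : V ≃ V` intertwining `ρ, ρ'` (apply `id ⊗ φ`, which preserves `D`, `Fil⁰` and `Fil⁰`-coboundaries and is
injective). [cite: Kato1993LNM1553, Ch. II Prop. 1.2.3] -/
theorem cupLogInjective_of_equiv (φ : M ≃ₗ[P] M) (hφ : ∀ σ m, φ (ρ σ m) = ρ' σ (φ m))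
    (hinj : 𝔅.CupLogInjective ψ ρ') : 𝔅.CupLogInjective ψ ρ := by
  have hback : ∀ x : 𝔅.B ⊗[P] M, 𝔅.tensorMap (φ.symm : M →ₗ[P] M) (𝔅.tensorMap (φ : M →ₗ[P] M) x) = x := by
    intro x
    induction x using TensorProduct.induction_on with
    | zero => simp
    | tmul b m => simp
    | add x y hx hy => rw [map_add, map_add, hx, hy]
  intro x hxD hxfil hcob
  have hmap := hinj (𝔅.tensorMap (φ : M →ₗ[P] M) x) (tensorMap_mem_D hφ hxD) (tensorMap_mem_filTensor 0 hxfil)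
    ((hcob.map hφ).congr fun σ => by rw [map_smul])
  rw [← hback x, hmap, map_zero]

end Equiv

/-! ### §2 (GAL_loc): Galois semilinearity of `exp*_ω` -/

section Galois

variable {K L : Type} [Field K] [ValuativeRel K] [TopologicalSpace K] [IsNonarchimedeanLocalField K] [CharZero K]
  [Field L] [ValuativeRel L] [TopologicalSpace L] [IsNonarchimedeanLocalField L] [CharZero L] [Algebra K L]
  {p : ℕ} [Fact p.Prime]
  [Fact (¬ IsUnit (p : integerC K))] [IsAdicComplete (Ideal.span {(p : integerC K)}) (integerC K)]
  [Fact (¬ IsUnit (p : integerC L))] [IsAdicComplete (Ideal.span {(p : integerC L)}) (integerC L)]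
  [Algebra ℚ_[p] K] [Algebra ℚ_[p] L] [IsScalarTower ℚ_[p] K L]
  (hK : valuation K p < 1) (hL : valuation L p < 1)
  (W : WeierstrassCurve ℚ) [W.IsElliptic] (r : absoluteGaloisGroup K →ₜ* absoluteGaloisGroup ℚ)

omit [IsScalarTower ℚ_[p] K L] in
include hK in
/-- **Step 1. The twisted period-ring automorphism `Θ = Φ ∘ (δ' •) ∘ Φ⁻¹` of `B_dR(L)`**: for `δ' ∈ Γ_K`, a
continuous homomorphism `s : Γ_L → Γ_L` with `res (s τ) = δ'⁻¹ · res τ · δ'` and a ring endomorphism `g` of `L`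
induced by `δ'` on `L ⊆ L̄ ≅ K̄`, there is an injective ring endomorphism `Θ` of `B_dR(L)` which is equivariant
over `s`, preserves `Fil⁰` and is `g`-semilinear on `L ⊆ B_dR(L)` — built from the filtered `res`-equivariant
base-change isomorphism `Φ : B_dR(K) ≃ B_dR(L)` (`exists_fracBdR_ringEquiv_filtered`) and the `Γ_K`-action on
`B_dR(K)`; the semilinearity is property (3) of `Φ` (compatibility with Fontaine's sections `F̄ → B_dR⁺(F)`) and the
`Γ_K`-equivariance of the section (`galBdRPlus_algClosureToBdR`).
[cite: BrinonConrad2009, Prop. 6.3.8] [cite: FontaineAsterisque223III, Exp. II §1.5] -/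
theorem exists_periodRing_twist (hcont : Continuous (algebraMap K L))
    (δ' : absoluteGaloisGroup K) (s : absoluteGaloisGroup L →ₜ* absoluteGaloisGroup L)
    (hs : ∀ τ, absGaloisRestrict K L (s τ) = δ'⁻¹ * absGaloisRestrict K L τ * δ')
    (g : L →+* L)
    (hg : ∀ (y : AlgebraicClosure K) (x : L), absClosureEmbedding K L y = algebraMap L (AlgebraicClosure L) x →
      absClosureEmbedding K L (δ' • y) = algebraMap L (AlgebraicClosure L) (g x)) :
    ∃ Θ : (bdRPeriodRingData (F := L) (p := p) hL).B →+* (bdRPeriodRingData (F := L) (p := p) hL).B,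
      Injective Θ ∧
      (∀ (τ : absoluteGaloisGroup L) (b : (bdRPeriodRingData (F := L) (p := p) hL).B), Θ (s τ • b) = τ • Θ b) ∧
      (∀ b, b ∈ (bdRPeriodRingData (F := L) (p := p) hL).fil 0 → Θ b ∈ (bdRPeriodRingData (F := L) (p := p) hL).fil 0) ∧
      (∀ e : L, Θ (algebraMap L (bdRPeriodRingData (F := L) (p := p) hL).B e) =
        algebraMap L (bdRPeriodRingData (F := L) (p := p) hL).B (g e)) := by
  have hFK : Surjective (fontaineTheta (integerC K) p) := surjective_fontaineTheta_integerC hK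
  have hFL : Surjective (fontaineTheta (integerC L) p) := surjective_fontaineTheta_integerC hL
  haveI := isDomain_bDeRhamPlus hFK
  haveI := isDomain_bDeRhamPlus hFL
  haveI : Algebra.IsAlgebraic K L := algebra_isAlgebraic_of_continuous_algebraMap hcont hK hL
  obtain ⟨Φ, hΦs, -, hΦalg, -, hΦfil⟩ := exists_fracBdR_ringEquiv_filtered (ℓ := p) hcont hK hL hFK hFL
  let 𝔅K := bdRPeriodRingData (F := K) (p := p) hK
  let 𝔅L := bdRPeriodRingData (F := L) (p := p) hL
  -- `Φ`, `Φ⁻¹` as ring homomorphisms of the period rings; `Φ⁻¹` is equivariant backwards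
  let Φr : 𝔅K.B →+* 𝔅L.B := Φ.toRingHom
  have hΦr : ∀ b, Φr b = Φ b := fun _ => rfl
  have hΦs' : ∀ (σ : absoluteGaloisGroup L) (b : 𝔅K.B), Φr (absGaloisRestrict K L σ • b) = σ • Φr b :=
    fun σ b => by rw [hΦr, hΦr]; exact hΦs σ b
  let Φi : 𝔅L.B →+* 𝔅K.B := Φ.symm.toRingHom
  have hΦΦi : ∀ b, Φr (Φi b) = b := fun b => Φ.apply_symm_apply b
  have hΦsymm : ∀ (σ : absoluteGaloisGroup L) (b : 𝔅L.B), Φi (σ • b) = absGaloisRestrict K L σ • Φi b :=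
    fun σ b => by
    apply Φ.injective
    rw [← hΦr, ← hΦr, hΦΦi, hΦs', hΦΦi]
  -- `Θ`
  refine ⟨Φr.comp ((MulSemiringAction.toRingHom (absoluteGaloisGroup K) 𝔅K.B δ').comp Φi),
    Φ.injective.comp ((MulSemiringAction.toRingEquiv (absoluteGaloisGroup K) 𝔅K.B δ').injective.comp
      Φ.symm.injective), fun τ b => ?_, fun b hb => ?_, fun e => ?_⟩
  · -- equivariance over `s`
    have hστ : δ' * (δ'⁻¹ * absGaloisRestrict K L τ * δ') = absGaloisRestrict K L τ * δ' := by group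
    change Φr (δ' • Φi (s τ • b)) = τ • Φr (δ' • Φi b)
    rw [hΦsymm, hs, ← mul_smul, hστ, mul_smul]
    exact hΦs' τ _
  · -- filtration
    change Φr (δ' • Φi b) ∈ 𝔅L.fil 0
    rw [hΦr]
    refine (hΦfil 0 _).1 (𝔅K.smul_mem_fil δ' 0 _ ((hΦfil 0 (Φi b)).2 ?_))
    rw [← hΦr, hΦΦi]
    exact hb
  · -- `g`-semilinearity on `L ⊆ B_dR(L)`, through Fontaine's sections
    obtain ⟨y, hy⟩ := (absClosureEmbedding_bijective K L).2 (algebraMap L (AlgebraicClosure L) e)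
    have heK : (algebraMap L 𝔅L.B e : FracBdR L p) =
        algebraMap (BDeRhamPlus (integerC L) p) (FracBdR L p) (algClosureToBdR hL hFL (absClosureEmbedding K L y)) := by
      rw [hy, algClosureToBdR_algebraMap]; rfl
    have h1 : Φ.symm (algebraMap L 𝔅L.B e) =
        algebraMap (BDeRhamPlus (integerC K) p) (FracBdR K p) (algClosureToBdR hK hFK y) :=
      Φ.injective (by rw [Φ.apply_symm_apply, hΦalg]; exact heK)
    change Φ (δ' • Φ.symm (algebraMap L 𝔅L.B e)) = _
    rw [h1, smul_algebraMap_fracBdR, galBdRPlus_algClosureToBdR, hΦalg, hg y e hy, algClosureToBdR_algebraMap]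
    rfl

omit [ValuativeRel K] [TopologicalSpace K] [IsNonarchimedeanLocalField K]
  [Fact (¬ IsUnit (p : integerC K))] [IsAdicComplete (Ideal.span {(p : integerC K)}) (integerC K)] in
/-- **Steps 2–3. Transport of `exp*_ω` along `Θ` and back along the intertwiner `φ = ρ(r δ')`**: for a ring
endomorphism `Θ` of `B_dR(L)` as in `exists_periodRing_twist` there is ONE scalar `e ∈ Lˣ` with
`exp*_{d_L}[c'] = e · g (exp*_{d_L}[c])` for every pair of continuous crossed homomorphisms with
`c'(τ) = r(δ') · c(s τ)` (w2-c2's abstract transport `dualExpCoord_filZeroLineTransport` with the coefficient field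
`L` twisted by `g`, then `FilZeroLine.map` / `dualExpCoord_map` along `φ`; `e` compares the resulting generator of
`Fil⁰ D(V_pW|_t)` with `ω_L`). [cite: Kato1993LNM1553, Ch. II §1.2.4 and Prop. 1.2.3] -/
theorem exists_scalar_expStarOmega_conj (δ' : absoluteGaloisGroup K) (s : absoluteGaloisGroup L →ₜ* absoluteGaloisGroup L)
    (hs : ∀ τ, absGaloisRestrict K L (s τ) = δ'⁻¹ * absGaloisRestrict K L τ * δ')
    (g : L →+* L) (hgK : ∀ x : K, g (algebraMap K L x) = algebraMap K L x)
    (Θ : (bdRPeriodRingData (F := L) (p := p) hL).B →+* (bdRPeriodRingData (F := L) (p := p) hL).B)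
    (hΘinj : Injective Θ)
    (hΘs : ∀ (τ : absoluteGaloisGroup L) (b : (bdRPeriodRingData (F := L) (p := p) hL).B), Θ (s τ • b) = τ • Θ b)
    (hΘfil : ∀ b, b ∈ (bdRPeriodRingData (F := L) (p := p) hL).fil 0 →
      Θ b ∈ (bdRPeriodRingData (F := L) (p := p) hL).fil 0)
    (hΘE : ∀ e : L, Θ (algebraMap L (bdRPeriodRingData (F := L) (p := p) hL).B e) =
      algebraMap L (bdRPeriodRingData (F := L) (p := p) hL).B (g e))
    (dL : LocalNeronLine W hL (r.comp (absGaloisRestrict K L)))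
    (hinjL : (bdRPeriodRingData hL).CupLogInjective (logCyclotomic p)
      (localRationalTateRep W p (r.comp (absGaloisRestrict K L))))
    (hexL : ∀ z : contOneCocycles (localRationalTateRep W p (r.comp (absGaloisRestrict K L))).toTopRep,
      (bdRPeriodRingData hL).HasDualExp (logCyclotomic p)
        (localRationalTateRep W p (r.comp (absGaloisRestrict K L))) fun σ => z.1 σ) :
    ∃ e : L, e ≠ 0 ∧ ∀ (c c' : contOneCocycles (localTateRep W p (r.comp (absGaloisRestrict K L))).toTopRep),
      (∀ τ, c'.1 τ = r δ' • c.1 (s τ)) →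
      expStarOmega hL (r.comp (absGaloisRestrict K L)) dL (oneCocycleClass _ c') =
        e * g (expStarOmega hL (r.comp (absGaloisRestrict K L)) dL (oneCocycleClass _ c)) := by
  let 𝔅L := bdRPeriodRingData (F := L) (p := p) hL
  let ρ : ContinuousRep (absoluteGaloisGroup L) ℚ_[p] (W.rationalTateModule p) :=
    localRationalTateRep W p (r.comp (absGaloisRestrict K L))
  have hgp : ∀ q : ℚ_[p], g (algebraMap ℚ_[p] L q) = algebraMap ℚ_[p] L q := fun q => by
    rw [IsScalarTower.algebraMap_apply ℚ_[p] K L, hgK]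
  have hψ : ∀ τ, logCyclotomic p τ = logCyclotomic p (s τ) := logCyclotomic_conj p δ' s hs
  -- the intertwiner `φ = ρ(r δ')` between the conjugate representation `ρ ∘ s` and `ρ`
  let Rℚ := W.rationalTateGaloisRep p (W.continuous_rationalGaloisRepTate_holds p)
  have hρ : ∀ σ, ρ σ = Rℚ (r (absGaloisRestrict K L σ)) := fun _ => rfl
  have hmul : ∀ (a b : absoluteGaloisGroup ℚ) (m : W.rationalTateModule p), Rℚ a (Rℚ b m) = Rℚ (a * b) m :=
    fun a b m => by rw [map_mul]; rfl
  have ht : ∀ τ, r (absGaloisRestrict K L (s τ)) = (r δ')⁻¹ * r (absGaloisRestrict K L τ) * r δ' :=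
    fun τ => by rw [hs, map_mul, map_mul, map_inv]
  let φ : W.rationalTateModule p ≃ₗ[ℚ_[p]] W.rationalTateModule p :=
    LinearEquiv.ofLinear (Rℚ (r δ')) (Rℚ (r δ')⁻¹)
      (LinearMap.ext fun m => by rw [LinearMap.comp_apply, hmul, mul_inv_cancel, map_one]; rfl)
      (LinearMap.ext fun m => by rw [LinearMap.comp_apply, hmul, inv_mul_cancel, map_one]; rfl)
  have hφapp : ∀ m, φ m = Rℚ (r δ') m := fun _ => rfl
  have hφ : ∀ τ m, φ ((ρ.restrict s) τ m) = ρ τ (φ m) := fun τ m => by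
    rw [ContinuousRep.restrict_apply, hφapp, hφapp, hρ, hρ, ht, hmul, hmul]
    congr 1
    group
  have hφ' : ∀ τ m, φ.symm (ρ τ m) = (ρ.restrict s) τ (φ.symm m) := fun τ m =>
    φ.injective (by rw [LinearEquiv.apply_symm_apply, hφ, LinearEquiv.apply_symm_apply])
  have hinj' : 𝔅L.CupLogInjective (logCyclotomic p) (ρ.restrict s) := cupLogInjective_of_equiv φ hφ hinjL
  -- the coefficient field `L` twisted by `g` (for w2-c2's abstract transport along `Θ`)
  letI algLL : Algebra L L := g.toAlgebra
  haveI istLL : @IsScalarTower ℚ_[p] L L _ algLL.toSMul _ :=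
    @IsScalarTower.of_algebraMap_eq' ℚ_[p] L L _ _ _ _ algLL _ (RingHom.ext fun q => (hgp q).symm)
  -- the transported generator on `ρ ∘ s` and its push-forward back to `ρ`; `Fil⁰ D(ρ)` is a line
  let dT : 𝔅L.FilZeroLine (ρ.restrict s) := filZeroLineTransport s ρ Θ hΘE hΘs hΘfil hΘinj dL (dL.map φ.symm hφ')
  let d₁ : 𝔅L.FilZeroLine ρ := dT.map φ hφ
  obtain ⟨e, he0, he⟩ := FilZeroLine.exists_ne_zero_and_eq_smul dL d₁
  refine ⟨e, he0, fun c c' hc' => ?_⟩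
  -- (T1) transport along `Θ`: `exp*_{(ρ∘s, dT)}(z ∘ s) = g (exp*_{(ρ, d_L)} z)`
  have hT1 : 𝔅L.dualExpCoord (logCyclotomic p) (ρ.restrict s) dT.ω (fun τ => (pushRational p c).1 (s τ)) =
      g (𝔅L.dualExpCoord (logCyclotomic p) ρ dL.ω fun σ => (pushRational p c).1 σ) :=
    dualExpCoord_filZeroLineTransport s ρ Θ hΘE hΘs hΘfil hΘinj dL (dL.map φ.symm hφ') hψ hinjL hinj'
      (hexL (pushRational p c))
  -- (T2) push along `φ`: `exp*_{(ρ, d₁)}(φ ∘ z ∘ s) = exp*_{(ρ∘s, dT)}(z ∘ s)`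
  have hz' : 𝔅L.HasDualExp (logCyclotomic p) (ρ.restrict s) fun τ => (pushRational p c).1 (s τ) :=
    hasDualExp_transport s ρ Θ hΘE hΘs hΘfil hψ (hexL (pushRational p c))
  have hT2 := FilZeroLine.dualExpCoord_map (ψ := logCyclotomic p) dT φ hφ hinj' hinjL hz'
  -- (T3) the pushed crossed homomorphism IS `c'`
  have hcc : (fun τ => φ ((pushRational p c).1 (s τ))) = fun τ => (pushRational p c').1 τ := by
    funext τ
    rw [pushRational_apply, pushRational_apply, hc', hφapp]
    rfl
  rw [hcc] at hT2
  -- (T4) `d₁ = e • d_L`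
  have hT4 : 𝔅L.dualExpCoord (logCyclotomic p) ρ d₁.ω (fun τ => (pushRational p c').1 τ) =
      e⁻¹ * 𝔅L.dualExpCoord (logCyclotomic p) ρ dL.ω fun τ => (pushRational p c').1 τ := by
    rw [he]
    exact dL.dualExpCoord_smul he0 _
  rw [expStarOmega_oneCocycleClass, expStarOmega_oneCocycleClass, ← hT1, ← hT2, hT4, ← mul_assoc,
    mul_inv_cancel₀ he0, one_mul]

omit [ValuativeRel K] [TopologicalSpace K] [IsNonarchimedeanLocalField K] [CharZero K]
  [ValuativeRel L] [TopologicalSpace L] [IsNonarchimedeanLocalField L] [CharZero L]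
  [Fact (¬ IsUnit (p : integerC K))] [IsAdicComplete (Ideal.span {(p : integerC K)}) (integerC K)]
  [Fact (¬ IsUnit (p : integerC L))] [IsAdicComplete (Ideal.span {(p : integerC L)}) (integerC L)]
  [Algebra ℚ_[p] K] [Algebra ℚ_[p] L] [IsScalarTower ℚ_[p] K L] [W.IsElliptic] in
/-- **Step 4 (conjugation acts trivially on the restriction of a class from `Γ_K`)**: if `c₀ = res η₀` for a
continuous crossed homomorphism `η₀` of `Γ_K` and `c₀'(τ) = r(δ') · c₀(s τ)`, then `[c₀'] = [c₀]` — they differ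
by the coboundary of `η₀(δ')` (Serre, *Corps locaux* VII §5 Prop. 3: inner automorphisms act trivially on `H¹`).
[cite: SerreLocalFields1979, VII §5 Prop. 3] -/
theorem oneCocycleClass_conj_res_eq (δ' : absoluteGaloisGroup K) (s : absoluteGaloisGroup L →ₜ* absoluteGaloisGroup L)
    (hs : ∀ τ, absGaloisRestrict K L (s τ) = δ'⁻¹ * absGaloisRestrict K L τ * δ')
    (η₀ : contOneCocycles (localTateRep W p r).toTopRep)
    (c₀ c₀' : contOneCocycles (localTateRep W p (r.comp (absGaloisRestrict K L))).toTopRep)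
    (hc₀ : ∀ τ, c₀.1 τ = η₀.1 (absGaloisRestrict K L τ)) (hc₀' : ∀ τ, c₀'.1 τ = r δ' • c₀.1 (s τ)) :
    oneCocycleClass _ c₀' = oneCocycleClass _ c₀ := by
  rw [← sub_eq_zero, ← oneCocycleClass_sub, oneCocycleClass_eq_zero_iff]
  refine ⟨η₀.1 δ', fun τ => ?_⟩
  change c₀'.1 τ - c₀.1 τ = r (absGaloisRestrict K L τ) • η₀.1 δ' - η₀.1 δ'
  rw [hc₀', hc₀, hc₀, hs]
  -- the cocycle identities of `η₀` on `Γ_K` (acting through `r`)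
  have hcoc : ∀ a b : absoluteGaloisGroup K, η₀.1 (a * b) = η₀.1 a + r a • η₀.1 b := fun a b => η₀.2 a b
  have h2 : r δ' • η₀.1 δ'⁻¹ = - η₀.1 δ' := by
    have h := hcoc δ' δ'⁻¹
    rw [mul_inv_cancel, contOneCocycles.apply_one] at h
    rw [eq_neg_iff_add_eq_zero, add_comm, ← h]
  rw [hcoc, hcoc, smul_add, smul_add, h2, ← mul_smul, ← mul_smul, ← map_mul, ← map_mul]
  have hg1 : δ' * δ'⁻¹ = 1 := mul_inv_cancel δ'
  have hg2 : δ' * (δ'⁻¹ * absGaloisRestrict K L τ) = absGaloisRestrict K L τ := by group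
  rw [hg1, hg2, map_one, one_smul]
  abel

/-- ★ **(GAL_loc): `exp*_ω` over `L` is semilinear for the action of `Γ_K` through `Gal(L/K)`** (module docstring):
for `c'(τ) = r(δ') · c(s τ)`, `exp*_{d_L}[c'] = g (exp*_{d_L}[c])`, under (RES) for `(d_K, d_L)`, one class with
`exp*_{d_K} ≠ 0`, and the Prop-1.2.3 binders over `L`.
[cite: Kato1993LNM1553, Ch. II §1.2.4 and Prop. 1.2.3] [cite: Kato2004Asterisque, §9.4 (p. 188)]
[cite: BrinonConrad2009, Prop. 6.3.8] [cite: FontaineAsterisque223III, Exp. II §1.5] -/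
theorem expStarOmega_galois (hcont : Continuous (algebraMap K L))
    (δ' : absoluteGaloisGroup K) (s : absoluteGaloisGroup L →ₜ* absoluteGaloisGroup L)
    (hs : ∀ τ, absGaloisRestrict K L (s τ) = δ'⁻¹ * absGaloisRestrict K L τ * δ')
    (g : L →+* L) (hgK : ∀ x : K, g (algebraMap K L x) = algebraMap K L x)
    (hg : ∀ (y : AlgebraicClosure K) (x : L), absClosureEmbedding K L y = algebraMap L (AlgebraicClosure L) x →
      absClosureEmbedding K L (δ' • y) = algebraMap L (AlgebraicClosure L) (g x))
    (dK : LocalNeronLine W hK r) (dL : LocalNeronLine W hL (r.comp (absGaloisRestrict K L)))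
    (hinjL : (bdRPeriodRingData hL).CupLogInjective (logCyclotomic p)
      (localRationalTateRep W p (r.comp (absGaloisRestrict K L))))
    (hexL : ∀ z : contOneCocycles (localRationalTateRep W p (r.comp (absGaloisRestrict K L))).toTopRep,
      (bdRPeriodRingData hL).HasDualExp (logCyclotomic p)
        (localRationalTateRep W p (r.comp (absGaloisRestrict K L))) fun σ => z.1 σ)
    (hres : ∀ y : (localTateRep W p r).cohomology 1,
      expStarOmega hL (r.comp (absGaloisRestrict K L)) dL
          ((localTateRep W p r).cohomologyRes (absGaloisRestrict K L) 1 y) =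
        algebraMap K L (expStarOmega hK r dK y))
    (h₀ : (localTateRep W p r).cohomology 1) (hh₀ : expStarOmega hK r dK h₀ ≠ 0)
    (c c' : contOneCocycles (localTateRep W p (r.comp (absGaloisRestrict K L))).toTopRep)
    (hc' : ∀ τ, c'.1 τ = r δ' • c.1 (s τ)) :
    expStarOmega hL (r.comp (absGaloisRestrict K L)) dL (oneCocycleClass _ c') =
      g (expStarOmega hL (r.comp (absGaloisRestrict K L)) dL (oneCocycleClass _ c)) := by
  obtain ⟨Θ, hΘinj, hΘs, hΘfil, hΘE⟩ := exists_periodRing_twist hK hL hcont δ' s hs g hg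
  obtain ⟨e, -, key⟩ := exists_scalar_expStarOmega_conj hL W r δ' s hs g hgK Θ hΘinj hΘs hΘfil hΘE dL hinjL hexL
  -- ### `e = 1`, by evaluating at the restriction of a representative of `h₀`
  obtain ⟨η₀, hη₀⟩ := oneCocycleClass_surjective _ h₀
  -- `c₀ = res η₀`
  let c₀ : contOneCocycles (localTateRep W p (r.comp (absGaloisRestrict K L))).toTopRep :=
    contOneCocycles.pullback (absGaloisRestrict K L)
      (Y := ((localTateRep W p r).restrict (absGaloisRestrict K L)).toTopRep)
      (TopRep.ofHom ⟨ContinuousLinearMap.id ℤ (W.tateModule p), fun _ => rfl⟩) η₀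
  have hc₀ : (localTateRep W p r).cohomologyRes (absGaloisRestrict K L) 1 (oneCocycleClass _ η₀) =
      oneCocycleClass _ c₀ :=
    cohomologyRes_oneCocycleClass _ _ η₀
  have hc₀app : ∀ τ, c₀.1 τ = η₀.1 (absGaloisRestrict K L τ) := fun _ => rfl
  -- `c₀' = τ ↦ r δ' • c₀ (s τ)`, the pull-back of `c₀` along `(s, r δ' • ·)`
  have ht : ∀ τ, r (absGaloisRestrict K L (s τ)) = (r δ')⁻¹ * r (absGaloisRestrict K L τ) * r δ' :=
    fun τ => by rw [hs, map_mul, map_mul, map_inv]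
  let X₀ := (W.tateGaloisRep p (W.continuous_galoisRepTate_holds p)).toIntRep.toTopRep
  let X := (localTateRep W p (r.comp (absGaloisRestrict K L))).toTopRep
  have hsq : ∀ τ : absoluteGaloisGroup L,
      (X₀.ρ (r δ')).comp ((TopRep.res (s : absoluteGaloisGroup L →* absoluteGaloisGroup L) X).ρ τ) =
        (X.ρ τ).comp (X₀.ρ (r δ')) := fun τ => by
    refine ContinuousLinearMap.ext fun a => ?_
    have hτ : r δ' * ((r δ')⁻¹ * r (absGaloisRestrict K L τ) * r δ') = r (absGaloisRestrict K L τ) * r δ' := by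
      group
    change r δ' • (r (absGaloisRestrict K L (s τ)) • a) = r (absGaloisRestrict K L τ) • (r δ' • a)
    rw [← mul_smul, ht, hτ, mul_smul]
  let fδ : TopRep.res (s : absoluteGaloisGroup L →* absoluteGaloisGroup L) X ⟶ X := TopRep.ofHom ⟨X₀.ρ (r δ'), hsq⟩
  let c₀' : contOneCocycles (localTateRep W p (r.comp (absGaloisRestrict K L))).toTopRep :=
    contOneCocycles.pullback s fδ c₀
  have hc₀' : ∀ τ, c₀'.1 τ = r δ' • c₀.1 (s τ) := fun _ => rfl
  have hcl : oneCocycleClass _ c₀' = oneCocycleClass _ c₀ :=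
    oneCocycleClass_conj_res_eq W r δ' s hs η₀ c₀ c₀' hc₀app hc₀'
  have hpin := key c₀ c₀' hc₀'
  rw [hcl, ← hc₀, hη₀, hres h₀, hgK] at hpin
  have he1 : e = 1 := by
    have hne : algebraMap K L (expStarOmega hK r dK h₀) ≠ 0 :=
      (map_ne_zero_iff _ (algebraMap K L).injective).2 hh₀
    have h3 : (e - 1) * algebraMap K L (expStarOmega hK r dK h₀) = 0 := by
      rw [sub_mul, one_mul, ← hpin, sub_self]
    exact sub_eq_zero.1 ((mul_eq_zero.1 h3).resolve_right hne)
  rw [key c c' hc', he1, one_mul]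

end Galois

end Summit.BirchSwinnertonDyer.BirchSwinnertonDyer.Theorems.KimAtThreeFineKatoExpStarGalois

end
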